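import Mathlib.MeasureTheory.Measure.HasOuterApproxClosed
import Mathlib.MeasureTheory.Integral.Prod
import Mathlib.Probability.ProbabilityMassFunction.Integrals
import Literature.Barriers.CriticalPhenomena.RigorousRGSmallParameterHHWReduction
import Literature.Barriers.CriticalPhenomena.RigorousRGSmallParameterHierarchicalIsing
import Literature.Probability.LatticeModels.IsingLimitLaw
import Literature.Probability.LatticeModels.LeeYangProofs
import Literature.Probability.LatticeModels.LeeYangTrigProduct
import HarnessLib

/-!
# The hierarchical Ising Gibbs measure behind the HHW trajectory: Lee–Yang for `h_N`

Companion to `RigorousRGSmallParameterHHWReduction.lean` (Hara–Hattori–Watanabe 2001,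
Theorem 1.1, decomposed there into the named parts `HaraHattoriWatanabe2001_eqA1`, `_thm21`,
`_thm22`). This file PROVES the Lee–Yang input of §2.2 for the `d = 4` trajectory
`traj s N = R^N h_{I,s}`:

* `isingMagnetizationLaw_dbl` — the **doubling identity**: for two copies of a finite Ising
  system with couplings `J ⊕ J` plus the top-level term `κ X'²` (`X' = k(X⁽⁰⁾ + X⁽¹⁾)` the new
  block spin), the magnetization law is `((μ ∗ μ).map (k·)).tilted (κx²)` — the block-spin
  identity `⟨F(φ')⟩_{Λ,h} = ⟨F⟩_{Λ-1,Rh}` ((1.2), p. 2) at the level of the block-spin variable,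
  for the tree's `isingMagnetizationLaw` (`IsingLimitLaw.lean`); proved by comparing integrals of
  bounded continuous functions (finite sums on both sides, Fubini on the product).
* `hierCoupling s N ≥ 0`, `hierWeight s N ≡ s(√c/2)^N` (`c = √2`, `hierK = 2^{1/4}/2`) and
  `traj_eq_isingMagnetizationLaw` — **`h_N` is the law of the block spin `(√c/2)^N Σ_θ sσ_θ` of the
  `2^N`-spin hierarchical Ising ferromagnet** (eq. (2.9)), by induction with the doubling identity.
* The Lee–Yang property of `h_N` is taken from the tree:
  `HierarchicalRG.hasLeeYangProperty_traj` of `RigorousRGSmallParameterHierarchicalIsing.lean`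
  (p20336, which proves (2.9) in its own Dirac-sum form `iterate_rgMap_isingLaw`,
  `integral_cexp_traj`, for every `0 < c ≤ 2`, `s ≥ 0`, from the tree's circle theorem
  `lee_yang_circle_theorem_finite_holds`). The present file re-expresses `h_N` as the tree's
  general `isingMagnetizationLaw` (doubling identity + `traj_eq_isingMagnetizationLaw`) so that
  `LeeYangTrigProduct` applies; the two descriptions of (2.9) are complementary, not duplicates.
* `charFun_traj_eq_trigProd` — **`ĥ_N(ξ) = cos(ξω)^a ∏_{θ∈S}(1 - sin²(ξω)/sin²(θ/2))`**,
  `ω = s(√c/2)^N`, `θ ∈ (0, π)`, `a + 2|S| = 2^N`, from `LeeYangTrig.exists_trig_prod`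
  (`LeeYangTrigProduct.lean`): the finite, Hadamard-free form of Newman's representation (A.1) for
  the lattice law `h_N`. The sibling `RigorousRGSmallParameterHHWLimit.lean` uses it to prove
  Theorem 1.1 from Theorems 2.1 and 2.2 alone.

With p20336's `hasLeeYangProperty_traj` the Lee–Yang half of `HaraHattoriWatanabe2001_eqA1`
(review note on p18714) is a theorem; the product half is replaced, for the purposes of
Theorem 1.1, by the finite trigonometric product.

## References

* T. Hara, T. Hattori, H. Watanabe, Comm. Math. Phys. 220 (2001) 13–40, §1 (pp. 1–2: `H_Λ`,
  (1.1), (1.2), block spins), §2.2 eq. (2.9), Appendix A (A.1).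
* C. M. Newman, Comm. Math. Phys. 41 (1975) 1–9, Theorem 1 (Lee–Yang), Proposition 2.
* T. D. Lee, C. N. Yang, Phys. Rev. 87 (1952) 410–419, Appendix II.
-/

noncomputable section



namespace Literature.Barriers.CriticalPhenomena

open _root_.MeasureTheory _root_.ProbabilityTheory _root_.Filter _root_.Set _root_.Finset
open Literature.Probability.LatticeModels
open scoped _root_.Topology _root_.ENNReal _root_.NNReal BigOperators

namespace HierarchicalRG

/-! ### Expectations under a finite Ising magnetization law -/

section IsingLaw

variable {n : ℕ}

/-- `|Σ wᵢ sᵢ| ≤ Σ |wᵢ|`. [folklore] -/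
theorem abs_weightedMagnetization_le (w : Fin n → ℝ) (s : Fin n → Bool) :
    |weightedMagnetization w s| ≤ ∑ i, |w i| := by
  unfold weightedMagnetization
  refine (Finset.abs_sum_le_sum_abs _ _).trans (Finset.sum_le_sum fun i _ => ?_)
  rw [abs_mul]
  have : |spinVal s i| = 1 := by unfold spinVal; split_ifs <;> simp
  rw [this, mul_one]

/-- **Expectations under a magnetization law are finite Gibbs averages**:
`∫ g d(law) = Σ_s e^{E(s)}/Z · g(M(s))`. [cite: Newman1974, §1] -/
theorem integral_isingMagnetizationLaw (J : Fin n → Fin n → ℝ) (w : Fin n → ℝ) {g : ℝ → ℝ}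
    (hg : Measurable g) :
    ∫ u, g u ∂(isingMagnetizationLaw n J w : Measure ℝ) =
      ∑ s : Fin n → Bool, isingBoltzmann J s / isingPairPartition J * g (weightedMagnetization w s) := by
  change ∫ u, g u ∂((isingPairPMF J).map (weightedMagnetization w)).toMeasure = _
  rw [← PMF.toMeasure_map (weightedMagnetization w) (isingPairPMF J) (measurable_of_config _),
    integral_map (measurable_of_config _).aemeasurable hg.aestronglyMeasurable, PMF.integral_eq_sum]
  refine Finset.sum_congr rfl fun s _ => ?_
  have hp : ((isingPairPMF J) s).toReal = isingBoltzmann J s / isingPairPartition J := by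
    rw [isingPairPMF, PMF.ofFintype_apply, ENNReal.toReal_ofReal
      (div_nonneg (isingBoltzmann_pos J s).le (isingPairPartition_pos J).le)]
  rw [hp, smul_eq_mul]

/-- A magnetization law is carried by `[-Σ|wᵢ|, Σ|wᵢ|]`. [folklore] -/
theorem ae_abs_le_isingMagnetizationLaw (J : Fin n → Fin n → ℝ) (w : Fin n → ℝ) :
    ∀ᵐ u ∂(isingMagnetizationLaw n J w : Measure ℝ), |u| ≤ ∑ i, |w i| := by
  change ∀ᵐ u ∂((isingPairPMF J).map (weightedMagnetization w)).toMeasure, |u| ≤ ∑ i, |w i|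
  have hs : MeasurableSet {a : ℝ | ¬ |a| ≤ ∑ i, |w i|} :=
    (isClosed_le continuous_abs continuous_const).measurableSet.compl
  rw [ae_iff, PMF.toMeasure_apply_eq_zero_iff _ hs, support_isingPairPMF_map, Set.disjoint_left]
  rintro _ ⟨s, rfl⟩ h
  exact h (abs_weightedMagnetization_le w s)

/-- **The law of `X + X'`, `X, X'` i.i.d. magnetizations**: `∫ G d(μ ∗ μ) = Σ_{s,s'} q_s q_{s'} G(M(s) + M(s'))`
(Fubini on the product of two finite Gibbs measures). [folklore] -/
theorem integral_conv_isingMagnetizationLaw (J : Fin n → Fin n → ℝ) (w : Fin n → ℝ) {G : ℝ → ℝ}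
    (hG : Continuous G) :
    ∫ y, G y ∂((isingMagnetizationLaw n J w : Measure ℝ) ∗ (isingMagnetizationLaw n J w : Measure ℝ)) =
      ∑ s : Fin n → Bool, ∑ s' : Fin n → Bool,
        isingBoltzmann J s / isingPairPartition J * (isingBoltzmann J s' / isingPairPartition J) *
          G (weightedMagnetization w s + weightedMagnetization w s') := by
  set μ : Measure ℝ := (isingMagnetizationLaw n J w : Measure ℝ) with hμ
  set R : ℝ := ∑ i, |w i| with hR
  unfold Measure.conv
  rw [integral_map (by fun_prop) (by fun_prop)]
  -- integrability on the product: bounded on the (bounded) support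
  obtain ⟨C, hC⟩ := (isCompact_Icc (a := -(R + R)) (b := R + R)).exists_bound_of_continuousOn
    hG.continuousOn
  have hint : Integrable (fun p : ℝ × ℝ => G (p.1 + p.2)) (μ.prod μ) := by
    refine Integrable.of_bound (by fun_prop) C ?_
    have h1 : ∀ᵐ p : ℝ × ℝ ∂(μ.prod μ), |p.1| ≤ R :=
      (Measure.quasiMeasurePreserving_fst (μ := μ) (ν := μ)).ae
        (ae_abs_le_isingMagnetizationLaw J w)
    have h2 : ∀ᵐ p : ℝ × ℝ ∂(μ.prod μ), |p.2| ≤ R :=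
      (Measure.quasiMeasurePreserving_snd (μ := μ) (ν := μ)).ae
        (ae_abs_le_isingMagnetizationLaw J w)
    filter_upwards [h1, h2] with p hp1 hp2
    refine hC _ ⟨?_, ?_⟩
    · linarith [(abs_le.1 hp1).1, (abs_le.1 hp2).1]
    · linarith [(abs_le.1 hp1).2, (abs_le.1 hp2).2]
  rw [integral_prod _ hint]
  have hinner : ∀ x : ℝ, ∫ y, G (x + y) ∂μ =
      ∑ s' : Fin n → Bool, isingBoltzmann J s' / isingPairPartition J *
        G (x + weightedMagnetization w s') := fun x =>
    integral_isingMagnetizationLaw J w (g := fun y => G (x + y)) (by fun_prop)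
  simp_rw [hinner]
  rw [integral_isingMagnetizationLaw J w (by fun_prop)]
  simp_rw [Finset.mul_sum]
  refine Finset.sum_congr rfl fun s _ => Finset.sum_congr rfl fun s' _ => by ring

end IsingLaw

/-! ### Doubling: two copies coupled through the square of the block spin -/

section Doubling

variable {m n : ℕ}

/-- Block-diagonal couplings of two copies of a system (`J ⊕ J`); an unfolding-friendly local
copy of `Matrix.fromBlocks J 0 0 J` on `Fin n ⊕ Fin n`. [folklore] -/
def blockDiag (J : Fin n → Fin n → ℝ) : Fin n ⊕ Fin n → Fin n ⊕ Fin n → ℝ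
  | Sum.inl i, Sum.inl j => J i j
  | Sum.inr i, Sum.inr j => J i j
  | Sum.inl _, Sum.inr _ => 0
  | Sum.inr _, Sum.inl _ => 0

/-- The weights of the doubled system: `w' = k·w` on each copy (block spin
`X' = k(X⁽⁰⁾ + X⁽¹⁾)`, `k = √c/2`). [cite: HaraHattoriWatanabe2001, §1 eq. (1.2)] -/
def dblWeight (e : Fin m ≃ Fin n ⊕ Fin n) (k : ℝ) (w : Fin n → ℝ) : Fin m → ℝ :=
  fun a => k * w (Sum.elim id id (e a))

/-- The couplings of the doubled system: `J ⊕ J` plus the top-level term `κ X'²`, i.e.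
`κ w'_a w'_b` on every ordered pair. [cite: HaraHattoriWatanabe2001, §1 (p. 1, `H_Λ`)] -/
def dblCoupling (e : Fin m ≃ Fin n ⊕ Fin n) (J : Fin n → Fin n → ℝ) (κ k : ℝ) (w : Fin n → ℝ) :
    Fin m → Fin m → ℝ :=
  fun a b => blockDiag J (e a) (e b) + κ * dblWeight e k w a * dblWeight e k w b

/-- The left copy of a configuration of the doubled system. [folklore] -/
def halfL (e : Fin m ≃ Fin n ⊕ Fin n) (σ : Fin m → Bool) : Fin n → Bool :=
  fun i => σ (e.symm (Sum.inl i))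

/-- The right copy of a configuration of the doubled system. [folklore] -/
def halfR (e : Fin m ≃ Fin n ⊕ Fin n) (σ : Fin m → Bool) : Fin n → Bool :=
  fun i => σ (e.symm (Sum.inr i))

/-- The configuration of the doubled system with prescribed copies. [folklore] -/
def glue (e : Fin m ≃ Fin n ⊕ Fin n) (σ₁ σ₂ : Fin n → Bool) : Fin m → Bool :=
  fun a => Sum.elim σ₁ σ₂ (e a)

/-- The left copy of a glued configuration. [folklore] -/
theorem halfL_glue (e : Fin m ≃ Fin n ⊕ Fin n) (σ₁ σ₂ : Fin n → Bool) :
    halfL e (glue e σ₁ σ₂) = σ₁ := by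
  funext i; simp [halfL, glue]

/-- The right copy of a glued configuration. [folklore] -/
theorem halfR_glue (e : Fin m ≃ Fin n ⊕ Fin n) (σ₁ σ₂ : Fin n → Bool) :
    halfR e (glue e σ₁ σ₂) = σ₂ := by
  funext i; simp [halfR, glue]

/-- Gluing the two copies of a configuration gives it back. [folklore] -/
theorem glue_halfL_halfR (e : Fin m ≃ Fin n ⊕ Fin n) (σ : Fin m → Bool) :
    glue e (halfL e σ) (halfR e σ) = σ := by
  funext a
  simp only [glue]
  rcases h : e a with i | i
  · show σ (e.symm (Sum.inl i)) = σ a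
    rw [← h, Equiv.symm_apply_apply]
  · show σ (e.symm (Sum.inr i)) = σ a
    rw [← h, Equiv.symm_apply_apply]

/-- Configurations of the doubled system are pairs of configurations (a local, unfolding-friendly
form of `(Equiv.sumArrowEquivProdArrow _ _ _).symm.trans (e.arrowCongr (Equiv.refl _))`).
[folklore] -/
def glueEquiv (e : Fin m ≃ Fin n ⊕ Fin n) : (Fin n → Bool) × (Fin n → Bool) ≃ (Fin m → Bool) where
  toFun p := glue e p.1 p.2
  invFun σ := (halfL e σ, halfR e σ)
  left_inv p := by cases p; simp [halfL_glue, halfR_glue]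
  right_inv σ := glue_halfL_halfR e σ

/-- A sum over the doubled index set splits into the two copies. [folklore] -/
theorem sum_eq_sum_add_sum (e : Fin m ≃ Fin n ⊕ Fin n) (F : Fin m → ℝ) :
    ∑ a, F a = ∑ i, F (e.symm (Sum.inl i)) + ∑ i, F (e.symm (Sum.inr i)) := by
  rw [← e.symm.sum_comp F, Fintype.sum_sum_type]

/-- Spins of the left copy. [folklore] -/
theorem spinVal_halfL (e : Fin m ≃ Fin n ⊕ Fin n) (σ : Fin m → Bool) (i : Fin n) :
    spinVal σ (e.symm (Sum.inl i)) = spinVal (halfL e σ) i := rfl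

/-- Spins of the right copy. [folklore] -/
theorem spinVal_halfR (e : Fin m ≃ Fin n ⊕ Fin n) (σ : Fin m → Bool) (i : Fin n) :
    spinVal σ (e.symm (Sum.inr i)) = spinVal (halfR e σ) i := rfl

/-- **The block spin of the doubled system is `k(X⁽⁰⁾ + X⁽¹⁾)`.**
[cite: HaraHattoriWatanabe2001, §1 (p. 2, block spins)] -/
theorem weightedMagnetization_dbl (e : Fin m ≃ Fin n ⊕ Fin n) (k : ℝ) (w : Fin n → ℝ)
    (σ : Fin m → Bool) :
    weightedMagnetization (dblWeight e k w) σ =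
      k * (weightedMagnetization w (halfL e σ) + weightedMagnetization w (halfR e σ)) := by
  unfold weightedMagnetization
  rw [sum_eq_sum_add_sum e]
  simp only [dblWeight, Equiv.apply_symm_apply, Sum.elim_inl, Sum.elim_inr, id, spinVal_halfL,
    spinVal_halfR, Finset.mul_sum, mul_add]
  congr 1 <;> exact Finset.sum_congr rfl fun i _ => by ring

/-- **The energy of the doubled system is `E(σ⁽⁰⁾) + E(σ⁽¹⁾) + κ X'²`** — the hierarchical
Hamiltonian's recursion `-βH_Λ = -βH_{Λ-1}⁽⁰⁾ - βH_{Λ-1}⁽¹⁾ + (β/2)φ'²`.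
[cite: HaraHattoriWatanabe2001, §1 (p. 1, `H_Λ`; p. 2, `R`)] -/
theorem isingPairEnergy_dbl (e : Fin m ≃ Fin n ⊕ Fin n) (J : Fin n → Fin n → ℝ) (κ k : ℝ)
    (w : Fin n → ℝ) (σ : Fin m → Bool) :
    isingPairEnergy (dblCoupling e J κ k w) σ =
      isingPairEnergy J (halfL e σ) + isingPairEnergy J (halfR e σ) +
        κ * weightedMagnetization (dblWeight e k w) σ ^ 2 := by
  have hsq : κ * weightedMagnetization (dblWeight e k w) σ ^ 2 =
      ∑ a, ∑ b, κ * ((dblWeight e k w a * spinVal σ a) * (dblWeight e k w b * spinVal σ b)) := by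
    rw [sq, weightedMagnetization, Finset.sum_mul_sum, Finset.mul_sum]
    simp_rw [Finset.mul_sum]
  have hblock : isingPairEnergy J (halfL e σ) + isingPairEnergy J (halfR e σ) =
      ∑ a, ∑ b, blockDiag J (e a) (e b) * spinVal σ a * spinVal σ b := by
    simp_rw [sum_eq_sum_add_sum e]
    simp [blockDiag, spinVal_halfL, spinVal_halfR, isingPairEnergy]
  rw [hsq, hblock, isingPairEnergy, ← Finset.sum_add_distrib]
  refine Finset.sum_congr rfl fun a _ => ?_
  rw [← Finset.sum_add_distrib]
  refine Finset.sum_congr rfl fun b _ => ?_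
  simp only [dblCoupling]
  ring

/-- The weights of the doubled system are `k·w` on either copy. [folklore] -/
theorem dblWeight_apply_inl (e : Fin m ≃ Fin n ⊕ Fin n) (k : ℝ) (w : Fin n → ℝ) (i : Fin n) :
    dblWeight e k w (e.symm (Sum.inl i)) = k * w i := by simp [dblWeight]

/-- The weights of the doubled system are `k·w` on either copy. [folklore] -/
theorem dblWeight_apply_inr (e : Fin m ≃ Fin n ⊕ Fin n) (k : ℝ) (w : Fin n → ℝ) (i : Fin n) :
    dblWeight e k w (e.symm (Sum.inr i)) = k * w i := by simp [dblWeight]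

/-- Non-negative couplings stay non-negative under doubling (`κ ≥ 0`, all weights of one sign).
[folklore] -/
theorem dblCoupling_nonneg (e : Fin m ≃ Fin n ⊕ Fin n) {J : Fin n → Fin n → ℝ}
    (hJ : ∀ i j, 0 ≤ J i j) {κ : ℝ} (hκ : 0 ≤ κ) (k : ℝ) {w : Fin n → ℝ}
    (hw : ∀ i j, 0 ≤ w i * w j) (a b : Fin m) : 0 ≤ dblCoupling e J κ k w a b := by
  unfold dblCoupling dblWeight
  refine add_nonneg ?_ ?_
  · rcases e a with i | i <;> rcases e b with j | j <;> simp [blockDiag, hJ]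
  · have : κ * (k * w (Sum.elim id id (e a))) * (k * w (Sum.elim id id (e b)))
        = κ * (k * k) * (w (Sum.elim id id (e a)) * w (Sum.elim id id (e b))) := by ring
    rw [this]
    exact mul_nonneg (mul_nonneg hκ (mul_self_nonneg k)) (hw _ _)

/-- **The doubling identity**: the magnetization law of the doubled system (couplings `J ⊕ J`
plus `κX'²`, weights `k·w`) is the block-spin transform of the magnetization law `μ` of one
copy — the law of `k(X + X')`, `X, X'` i.i.d. `∼ μ`, tilted by `e^{κx²}` and normalised. This is
the measure-theoretic content of `⟨F(φ')⟩_{Λ,h} = ⟨F⟩_{Λ-1,Rh}` ((1.2), p. 2) at the level of the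
block-spin variable. [cite: HaraHattoriWatanabe2001, §1 eq. (1.2) (p. 2)] -/
theorem isingMagnetizationLaw_dbl (e : Fin m ≃ Fin n ⊕ Fin n) (J : Fin n → Fin n → ℝ)
    (κ k : ℝ) (w : Fin n → ℝ) :
    (isingMagnetizationLaw m (dblCoupling e J κ k w) (dblWeight e k w) : Measure ℝ) =
      (((isingMagnetizationLaw n J w : Measure ℝ) ∗ (isingMagnetizationLaw n J w : Measure ℝ)).map
        (fun x => k * x)).tilted (fun x => κ * x ^ 2) := by
  set μ : Measure ℝ := (isingMagnetizationLaw n J w : Measure ℝ) with hμ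
  set ρ : Measure ℝ := (μ ∗ μ).map (fun x => k * x) with hρ
  -- abbreviations for the finite sums
  set q : (Fin n → Bool) → ℝ := fun s => isingBoltzmann J s / isingPairPartition J with hq
  set M : (Fin n → Bool) → ℝ := weightedMagnetization w with hM
  -- integrals against `ρ` of continuous functions
  have hρint : ∀ {G : ℝ → ℝ}, Continuous G → ∫ y, G y ∂ρ =
      ∑ s, ∑ s', q s * q s' * G (k * (M s + M s')) := by
    intro G hG
    rw [hρ, integral_map (by fun_prop) (by fun_prop)]
    exact integral_conv_isingMagnetizationLaw J w (G := fun x => G (k * x)) (by fun_prop)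
  -- the tilt normaliser
  set Zt : ℝ := ∫ y, Real.exp (κ * y ^ 2) ∂ρ with hZt
  have hZt_eq : Zt = ∑ s, ∑ s', q s * q s' * Real.exp (κ * (k * (M s + M s')) ^ 2) :=
    hρint (by fun_prop)
  have hq_pos : ∀ s, 0 < q s := fun s =>
    div_pos (isingBoltzmann_pos J s) (isingPairPartition_pos J)
  have hZt_pos : 0 < Zt := by
    rw [hZt_eq]
    refine Finset.sum_pos (fun s _ => Finset.sum_pos (fun s' _ => ?_) Finset.univ_nonempty)
      Finset.univ_nonempty
    exact mul_pos (mul_pos (hq_pos s) (hq_pos s')) (Real.exp_pos _)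
  -- the partition function of the doubled system
  have hB' : ∀ σ : Fin m → Bool, isingBoltzmann (dblCoupling e J κ k w) σ =
      isingBoltzmann J (halfL e σ) * isingBoltzmann J (halfR e σ) *
        Real.exp (κ * (k * (M (halfL e σ) + M (halfR e σ))) ^ 2) := by
    intro σ
    rw [isingBoltzmann, isingPairEnergy_dbl, weightedMagnetization_dbl, Real.exp_add, Real.exp_add]
    rfl
  have hZ0 : isingPairPartition J ≠ 0 := (isingPairPartition_pos J).ne'
  have hZ' : isingPairPartition (dblCoupling e J κ k w) =
      isingPairPartition J ^ 2 * Zt := by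
    rw [isingPairPartition, ← (glueEquiv e).sum_comp, Fintype.sum_prod_type]
    simp only [glueEquiv, Equiv.coe_fn_mk, hB', halfL_glue, halfR_glue]
    rw [hZt_eq, Finset.mul_sum]
    refine Finset.sum_congr rfl fun s _ => ?_
    rw [Finset.mul_sum]
    refine Finset.sum_congr rfl fun s' _ => ?_
    simp only [hq]
    field_simp
  -- compare integrals of bounded continuous functions
  haveI : IsFiniteMeasure (ρ.tilted fun x => κ * x ^ 2) := inferInstance
  refine ext_of_forall_integral_eq_of_IsFiniteMeasure fun f => ?_
  rw [integral_isingMagnetizationLaw _ _ f.continuous.measurable, integral_tilted,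
    ← (glueEquiv e).sum_comp, Fintype.sum_prod_type]
  have hrhs : ∫ x, (Real.exp (κ * x ^ 2) / ∫ x, Real.exp (κ * x ^ 2) ∂ρ) • f x ∂ρ =
      ∑ s, ∑ s', q s * q s' * (Real.exp (κ * (k * (M s + M s')) ^ 2) / Zt *
        f (k * (M s + M s'))) := by
    rw [← hZt]
    have := hρint (G := fun x => (Real.exp (κ * x ^ 2) / Zt) * f x) (by fun_prop)
    simpa only [smul_eq_mul] using this
  rw [hrhs]
  refine Finset.sum_congr rfl fun s _ => Finset.sum_congr rfl fun s' _ => ?_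
  simp only [glueEquiv, Equiv.coe_fn_mk, hB', halfL_glue, halfR_glue, weightedMagnetization_dbl,
    hZ']
  simp only [hq, hM]
  field_simp

end Doubling

/-! ### The hierarchical Ising Gibbs measures behind the trajectory (`d = 4`) -/

section Hierarchical

/-- Splitting the `2^{N+1}` spins of level `N + 1` into two blocks of `2^N`. [folklore] -/
def splitEquiv (N : ℕ) : Fin (2 ^ (N + 1)) ≃ Fin (2 ^ N) ⊕ Fin (2 ^ N) :=
  (finCongr (by ring)).trans finSumFinEquiv.symm

/-- The block-spin scale factor `√c/2` at `d = 4` (`c = √2`): `k = 2^{1/4}/2`.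
[cite: HaraHattoriWatanabe2001, §1 eq. (1.4) and p. 2] -/
def hierK : ℝ := Real.sqrt (Real.sqrt 2) / 2

/-- The weights of the level-`N` block spin `X_N = (√c/2)^N Σ_θ φ_θ`, `φ_θ = s σ_θ`: all equal to
`s (√c/2)^N`. [cite: HaraHattoriWatanabe2001, §2.2 eq. (2.9)] -/
def hierWeight (s : ℝ) (N : ℕ) : Fin (2 ^ N) → ℝ := fun _ => s * hierK ^ N

/-- The pair couplings `J⁽ᴺ⁾ ≥ 0` of the level-`N` hierarchical Ising Gibbs factor
`exp(-βH_N(sσ)) = exp(Σᵢⱼ J⁽ᴺ⁾ᵢⱼ σᵢσⱼ)`, `-βH_N = (β/2) Σ_{n=1}^{N} (c/4)ⁿ Σ_{blocks} (Σ_{block} φ)²`,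
built recursively: `J⁽⁰⁾ = 0` and `J⁽ᴺ⁺¹⁾ = J⁽ᴺ⁾ ⊕ J⁽ᴺ⁾ + (β/2) X_{N+1}²`.
[cite: HaraHattoriWatanabe2001, §1 (p. 1, `H_Λ`, (1.1))] -/
def hierCoupling (s : ℝ) : (N : ℕ) → Fin (2 ^ N) → Fin (2 ^ N) → ℝ
  | 0 => fun _ _ => 0
  | N + 1 => dblCoupling (splitEquiv N) (hierCoupling s N) (beta (Real.sqrt 2) / 2) hierK
      (hierWeight s N)

/-- `k = 2^{1/4}/2 > 0`. [folklore] -/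
theorem hierK_pos : 0 < hierK := by
  unfold hierK
  have : 0 < Real.sqrt (Real.sqrt 2) := Real.sqrt_pos.2 (Real.sqrt_pos.2 (by norm_num))
  positivity

/-- `β = 1/√2 - 1/2 > 0` at `d = 4`. [cite: HaraHattoriWatanabe2001, §1 eq. (1.1), (1.4)] -/
theorem beta_sqrt_two_pos : 0 < beta (Real.sqrt 2) := by
  unfold beta
  have h2 : Real.sqrt 2 < 2 := by
    rw [Real.sqrt_lt' (by norm_num : (0:ℝ) < 2)]; norm_num
  have h0 : 0 < Real.sqrt 2 := Real.sqrt_pos.2 (by norm_num)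
  rw [sub_pos, one_div_lt_one_div (by norm_num) h0]
  exact h2

/-- Doubling the level-`N` weights gives the level-`N+1` weights. [folklore] -/
theorem dblWeight_hierWeight (s : ℝ) (N : ℕ) :
    dblWeight (splitEquiv N) hierK (hierWeight s N) = hierWeight s (N + 1) := by
  funext a
  simp only [dblWeight, hierWeight]
  ring

/-- The couplings are ferromagnetic: `J⁽ᴺ⁾ᵢⱼ ≥ 0`. [cite: HaraHattoriWatanabe2001, §1 (p. 1)] -/
theorem hierCoupling_nonneg (s : ℝ) : ∀ (N : ℕ) (i j : Fin (2 ^ N)), 0 ≤ hierCoupling s N i j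
  | 0, _, _ => le_rfl
  | N + 1, i, j => by
    simp only [hierCoupling]
    exact dblCoupling_nonneg _ (hierCoupling_nonneg s N) (div_nonneg beta_sqrt_two_pos.le
      (by norm_num)) _ (fun _ _ => mul_self_nonneg _) i j

/-- The Ising law of one spin is the magnetization law of the one-spin system:
`h_{I,s} = ½(δ_s + δ_{-s})`. [cite: HaraHattoriWatanabe2001, §1 eq. (1.6)] -/
theorem isingLaw_eq_isingMagnetizationLaw (s : ℝ) :
    IsingStrongCouplingLimit.isingLaw s =
      (isingMagnetizationLaw (2 ^ 0) (hierCoupling s 0) (hierWeight s 0) : Measure ℝ) := by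
  refine ext_of_forall_integral_eq_of_IsFiniteMeasure fun f => ?_
  rw [IsingStrongCouplingLimit.integral_isingLaw,
    integral_isingMagnetizationLaw _ _ f.continuous.measurable]
  have hB : ∀ σ : Fin (2 ^ 0) → Bool, isingBoltzmann (hierCoupling s 0) σ = 1 := by
    intro σ; simp [isingBoltzmann, isingPairEnergy, hierCoupling]
  have hZ : isingPairPartition (hierCoupling s 0) = 2 := by
    simp only [isingPairPartition, hB, Finset.sum_const, Finset.card_univ, Fintype.card_fun,
      Fintype.card_bool, Fintype.card_fin, pow_zero, pow_one, nsmul_eq_mul, mul_one]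
    norm_num
  simp only [hB, hZ]
  -- configurations of one spin are Booleans
  let E : (Fin (2 ^ 0) → Bool) ≃ Bool :=
    (Equiv.arrowCongr (finCongr (pow_zero 2)) (Equiv.refl Bool)).trans (Equiv.funUnique (Fin 1) Bool)
  have hmag : ∀ b : Bool, weightedMagnetization (hierWeight s 0) (E.symm b) =
      s * (if b then 1 else -1) := by
    intro b
    unfold weightedMagnetization
    have hconst : ∀ i : Fin (2 ^ 0), hierWeight s 0 i * spinVal (E.symm b) i =
        s * (if b then 1 else -1) := by
      intro i
      simp [hierWeight, spinVal, E, Equiv.funUnique, Equiv.arrowCongr]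
    rw [Finset.sum_congr rfl fun i _ => hconst i, Finset.sum_const, Finset.card_univ,
      Fintype.card_fin, pow_zero, one_smul]
  rw [← Fintype.sum_equiv E.symm (fun b => 1 / 2 * f (weightedMagnetization (hierWeight s 0)
    (E.symm b))) _ (fun _ => rfl), Fintype.sum_bool, hmag, hmag]
  simp
  ring

/-- **The trajectory is the law of the block spin of the hierarchical Ising model**:
`h_N = R^N h_{I,s}` is the magnetization law of `2^N` spins `±1` with the ferromagnetic couplings
`J⁽ᴺ⁾` and equal weights `s(√c/2)^N` — the identity `⟨F(φ')⟩_{Λ,h} = ⟨F⟩_{Λ-1,Rh}` (p. 2)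
iterated, i.e. (2.9). [cite: HaraHattoriWatanabe2001, §1 (p. 2) and §2.2 eq. (2.9)] -/
theorem traj_eq_isingMagnetizationLaw (s : ℝ) (N : ℕ) :
    traj s N = (isingMagnetizationLaw (2 ^ N) (hierCoupling s N) (hierWeight s N) : Measure ℝ) := by
  induction N with
  | zero => exact isingLaw_eq_isingMagnetizationLaw s
  | succ N ih =>
    rw [traj_succ, ih, HierarchicalRG.rgMap]
    rw [show hierCoupling s (N + 1) = dblCoupling (splitEquiv N) (hierCoupling s N)
      (beta (Real.sqrt 2) / 2) hierK (hierWeight s N) from rfl, ← dblWeight_hierWeight,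
      isingMagnetizationLaw_dbl]
    rfl

/-- **The Laplace transform of `h_N`** is the normalised partition function of the hierarchical
Ising model in the field `z X_N`: `∫ e^{zu} h_N(u)du = Z_N(z)/Z_N(0)`.
[cite: HaraHattoriWatanabe2001, §2.2 eq. (2.9)] -/
theorem integral_exp_traj (s : ℝ) (N : ℕ) (z : ℂ) :
    ∫ u, Complex.exp (z * u) ∂(traj s N) =
      isingFieldPartition (hierCoupling s N) (hierWeight s N) z /
        isingPairPartition (hierCoupling s N) := by
  rw [traj_eq_isingMagnetizationLaw, integral_exp_isingMagnetizationLaw]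

/-- `Σᵢ σᵢ = 2·#{i : σᵢ = +} - n` for `n` spins `±1`. [folklore] -/
theorem sum_spinVal_eq {n : ℕ} (σ : Fin n → Bool) :
    ∑ i, spinVal σ i = 2 * ((Finset.univ.filter fun i => σ i = true).card : ℝ) - n := by
  have h : ∀ i, spinVal σ i = 2 * (if σ i = true then (1 : ℝ) else 0) - 1 := by
    intro i; unfold spinVal; split_ifs <;> norm_num
  simp_rw [h, Finset.sum_sub_distrib, ← Finset.mul_sum, Finset.sum_boole, Finset.sum_const,
    Finset.card_univ, Fintype.card_fin]
  simp

/-- The Laplace transform of `h_N` is the exponential polynomial of a lattice law: masses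
`e^{Σ Jσσ}/Z` at `ω(2d - 2^N)`, `ω = s(√c/2)^N`, `d = #{+ spins}`.
[cite: HaraHattoriWatanabe2001, §2.2 eq. (2.9)] -/
theorem integral_exp_traj_eq_expPoly (s : ℝ) (N : ℕ) (z : ℂ) :
    ∫ u, Complex.exp (z * u) ∂(traj s N) =
      LeeYangTrig.expPoly (fun σ : Fin (2 ^ N) → Bool =>
        isingBoltzmann (hierCoupling s N) σ / isingPairPartition (hierCoupling s N))
        (fun σ => (Finset.univ.filter fun i => σ i = true).card) (2 ^ N) (s * hierK ^ N) z := by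
  rw [integral_exp_traj, isingFieldPartition, LeeYangTrig.expPoly, Finset.sum_div]
  refine Finset.sum_congr rfl fun σ _ => ?_
  have hM : weightedMagnetization (hierWeight s N) σ =
      (s * hierK ^ N) * (2 * ((Finset.univ.filter fun i => σ i = true).card : ℝ) - (2 ^ N : ℕ)) := by
    rw [weightedMagnetization, ← sum_spinVal_eq, Finset.mul_sum]
    rfl
  rw [hM]
  push_cast
  ring

/-- **The characteristic function of `h_N` as a finite trigonometric product** (`s > 0`):
`ĥ_N(ξ) = cos(ξω)^a ∏_{θ∈S}(1 - sin²(ξω)/sin²(θ/2))`, `ω = s(√c/2)^N`, `θ ∈ (0,π)`,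
`a + 2|S| = 2^N` — Lee–Yang for the hierarchical Ising block spin ((2.9), via the tree's circle
theorem) followed by the root pairing of `LeeYangTrigProduct`; an elementary finite form of the
Newman/Hadamard representation (A.1) used in §2.2. PROVED.
[cite: HaraHattoriWatanabe2001, §2.2 eq. (2.9) and Appendix A eq. (A.1)]
[cite: LeeYang1952, Appendix II] -/
theorem charFun_traj_eq_trigProd {s : ℝ} (hs : 0 < s) (N : ℕ) :
    ∃ (a : ℕ) (S : Multiset ℝ), (∀ θ ∈ S, 0 < θ ∧ θ < Real.pi) ∧
      a + 2 * Multiset.card S = 2 ^ N ∧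
      ∀ ξ : ℝ, charFun (traj s N) ξ = ((Real.cos (ξ * (s * hierK ^ N)) ^ a *
        (S.map fun θ => 1 - Real.sin (ξ * (s * hierK ^ N)) ^ 2 / Real.sin (θ / 2) ^ 2).prod : ℝ) : ℂ) := by
  set J := hierCoupling s N with hJ
  set c : (Fin (2 ^ N) → Bool) → ℝ := fun σ => isingBoltzmann J σ / isingPairPartition J with hc_def
  set deg : (Fin (2 ^ N) → Bool) → ℕ := fun σ => (Finset.univ.filter fun i => σ i = true).card
    with hdeg_def
  have hc : ∀ σ, 0 < c σ := fun σ => div_pos (isingBoltzmann_pos J σ) (isingPairPartition_pos J)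
  have hdeg : ∀ σ, deg σ ≤ 2 ^ N := fun σ => by
    simpa [hdeg_def] using Finset.card_filter_le (Finset.univ : Finset (Fin (2 ^ N))) _
  have hi₀ : deg (fun _ => false) = 0 := by simp [hdeg_def]
  have hi₁ : deg (fun _ => true) = 2 ^ N := by simp [hdeg_def]
  have hc1 : ∑ σ, c σ = 1 := by
    simp only [hc_def, ← Finset.sum_div]
    exact div_self (isingPairPartition_pos J).ne'
  have hω : s * hierK ^ N ≠ 0 := (mul_pos hs (pow_pos hierK_pos N)).ne'
  have hLY : ∀ z : ℂ, LeeYangTrig.expPoly c deg (2 ^ N) (s * hierK ^ N) z = 0 → z.re = 0 := by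
    intro z hz
    refine hasLeeYangProperty_traj hs.le N z ?_
    rw [integral_exp_traj_eq_expPoly]
    exact hz
  obtain ⟨a, S, hS, hcard, hprod⟩ := LeeYangTrig.exists_trig_prod hc hdeg hi₀ hi₁ hc1 hω hLY
  refine ⟨a, S, hS, hcard, fun ξ => ?_⟩
  rw [← hprod ξ, ← complexMGF_id_mul_I]
  simp only [complexMGF, id]
  exact integral_exp_traj_eq_expPoly s N _

end Hierarchical

end HierarchicalRG

end Literature.Barriers.CriticalPhenomena

end
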